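import Summits.ABC.IUTFork.Conditional.WRowLicenceTripleEventually
import HarnessLib

/-!
# Branch C / R-W, reading (U): S_H and the (U) number-level Corollary at EVERY genuine Θ-datum of EVERY abc triple, at every prime
# `l` above the odd bad primes and above `4·p^{⌊v_p(abc)/2⌋}` — the SHARP form of «C:COR312U-EVENTUAL» (abc-iut cell, branch C; seat
# abc-iut-C-cert-2 gen 6; v2 of `Conditional/WRowLicenceTripleEventually`, same row)

Record-only PROOF file (D-0012; 0 definitions, 0 `Prop` facts, nothing re-typed) of the abc-iut cell. TAKES NO SIDE on [IUTchIII]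
Cor. 3.12 (S. Mochizuki, *Inter-universal Teichmüller theory III*, Cor. 3.12 p. 173–174; Step (xi-f) p. 184) or on any author; «inhabited
as typed» ≠ «asserted in print».

`Conditional/WRowLicenceTripleEventually` (this seat, p501279) discharged abc-iut-W-row-1's triple socket `WRow.licence_triple_unconditional`
for EVERY abc triple with the envelope exponents `A_p = B_p = ⌊v_p(abc)/2⌋` at every prime `l > 4·abc`. Its proof used the level only three
times: `l ≠ 2`; `p < l` for every odd bad prime `p` (so that `e`, a multiple of `l`, is off the cyclotomic indices `p^m(p−1)`); and
`2·p^{⌊v_p/2⌋} ≤ (l−1)/2` (the envelope member against the top label). THIS FILE states exactly that: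

* **`WRow.hcell_triple_of_primePow_lt`** — the socket hypothesis `hcell` for every abc triple at every prime `l ≥ 5` with
  `p < l ∧ 4·p^{⌊v_p(abc)/2⌋} < l` for every odd prime `p ∣ abc` (same cells, same `WRow.cell_core_of_large`);
* **`WRow.hcell_triple_of_sq_lt`** — in particular at every prime `l` with `16·abc < l²`, i.e. `l > 4·√(abc)` (an odd bad prime has
  `p² ≤ c² ≤ 2·abc`, and `(p^{⌊v/2⌋})² ≤ p^v ≤ abc`);
* **`WRow.licence_triple_of_primePow_lt`** — S_H INHABITED there (`j(a/c) ≠ 1728`): `Thm311ToCor312.Licence` at the sharp setting of every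
  genuine Θ-volume datum, for every pair of realising ideles — the socket's conclusion VERBATIM;
* **`WRow.cor312Of_triple_of_primePow_lt`**, **`WRow.cor312Of_triple_of_sq_lt`** — hence `T.Cor312Of` (READING (U)), as in v1.

READING (neutral; numbers, not adjectives). For SQUAREFREE `abc` every `⌊v_p/2⌋ = 0`, so S_H and `T.Cor312Of` hold at every genuine datum for
EVERY prime `l ≥ 5` exceeding the largest odd prime factor of `abc`; in general the level is `max(p_max, 4·max_p p^{⌊v_p/2⌋}) < l` instead of
`4·abc < l` (e.g. `3·5⁶7⁸53 + 167⁹ = 2·11⁶193⁴·20551`: every prime `l > 4·167⁴ = 3111185284`, against `4·abc ≈ 10⁵³`; abc-iut-W-num-6's REF band for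
that triple ends at `l = 153707341` — consistent, and the levels in between stay the R-W table's business). The exact per-triple thresholds of
record remain the R-W numerics lead's (W-neg-1 `…_uniform`, W-num-* bands); this file is the closed form for ALL triples. HONEST SCOPE as in v1: OUR
sharp containers and Dupuy–Hilado's typed (Ind1)/(Ind2); STRONGER-THAN-PRINT hull reading; non-emptiness of the datum type, admissibility and
Szpiro-badness NOT claimed; nothing about the printed GLOBAL inequality; typed ≠ proved; instantiated ≠ endorsed; no abc claim.
[cite: Mochizuki2012, IUTchI Def. 3.1 (b),(c) pp. 61–62, Ex. 3.2 (iv) p. 71; IUTchIII Cor. 3.12 Step (xi-f) p. 184; IUTchIV Prop. 1.2 (i)(ii) p. 10,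
Prop. 1.4 (ii) p. 13, Cor. 2.2 (ii) proof (P5) p. 46] [cite: DupuyHilado2025, §3.3, §3.4, §4.9, §4.12] [claim: Mochizuki2012, status: disputed] for every
IUT sentence. PROOF-ONLY: no definitions.
-/

noncomputable section

open Set Function NumberField IsDedekindDomain

namespace Summit.ABC.IUTFork.Conditional

open Thm311 Thm311.Real Cor312 Cor312Vol Cor312Prov Literature.IUT.LogThetaLattice Literature.IUT.LogVolume
  Literature.IUT.HodgeTheaters Literature.IUT.LogVolume.ThetaData Literature.IUT.LogVolume.Cor22
open Literature.NumberTheory.NumberFields Literature.NumberTheory.GaloisRepresentations.Ultrametric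
open Literature.NumberTheory.DiophantineGeometry Literature.NumberTheory.DiophantineGeometry.GenEll Summit.ABC.ABC.Theorems

/-! ## §1. The socket hypothesis `hcell` above the odd bad primes and `4·p^{⌊v_p/2⌋}` -/

/-- **`hcell` of `WRow.licence_triple_unconditional` for EVERY abc triple at EVERY prime `l ≥ 5` with `p < l` and `4·p^{⌊v_p(abc)/2⌋} < l`
for every odd prime `p ∣ abc`**, envelope exponents `A_p = B_p = ⌊v_p(abc)/2⌋`. Per bad prime `p ≠ 2, l` and admissible `e = l·k`:
`e ≠ p^m·(p−1)` because the prime `l > p` divides `e`; the `q`-pilot order is `k·v_p`; the floored cell is at most the floor-free one, the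
`min` of the two (equal) envelope members is the first, the different term is `≥ e − 1`, the inner-radius term is `≥ 0`; then
`WRow.cell_core_of_large` with `L = (l−1)/2 ≥ 2·p^{⌊v_p/2⌋}`. (The proof of `WRow.hcell_triple_of_large`, with its three uses of `4·abc < l`
replaced by the hypotheses.) [cite: Mochizuki2012, IUTchIV Prop. 1.2 (i)(ii) p. 10, Prop. 1.4 (ii) p. 13] [cite: DupuyHilado2025, §4.9]
[claim: Mochizuki2012, status: disputed] -/
theorem WRow.hcell_triple_of_primePow_lt {a b c l : ℕ} (habc : IsABCTriple a b c) (hl : l.Prime) (hl5 : 5 ≤ l)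
    (hbad : ∀ p : ℕ, p.Prime → p ∣ a * b * c → p ≠ 2 → p < l ∧ 4 * p ^ ((a * b * c).factorization p / 2) < l) :
    ∀ p : ℕ, p.Prime → p ∣ a * b * c → p ≠ 2 → p ≠ l → ∀ e : ℕ, 0 < e → l ∣ e →
      15 * l ∣ e * (a * b * c).factorization p → (p ∣ 30 → (p - 1) ∣ e) →
      (p ∣ c → Odd ((a * b * c).factorization p) → 30 * l ∣ e * (a * b * c).factorization p) →
      (∀ k : ℕ, (e : ℤ) ≠ (p : ℤ) ^ k * ((p : ℤ) - 1)) ∧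
      ∀ i : ℕ, i < (l - 1) / 2 →
        (e : ℤ) * ((((i + 1 : ℕ) : ℤ) ^ 2 * ((e * (2 * (a * b * c).factorization p) / (2 * l) : ℕ) : ℤ) -
            ((i + 1 : ℕ) : ℤ) * (((if p ∣ 30 ∧ ¬ p ∣ (a * b * c).factorization p then 2 * e - 1 else e - 1 : ℕ) : ℕ) : ℤ) -
            ((i + 2 : ℕ) : ℤ) * (if p ∣ 30 then (((e / (p - 1) : ℕ) : ℤ)) else (1 : ℤ))) / (e : ℤ)) +
          ((i + 2 : ℕ) : ℤ) * min ((p : ℤ) ^ ((fun p => (a * b * c).factorization p / 2) p) -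
              (((fun p => (a * b * c).factorization p / 2) p : ℕ) : ℤ) * (e : ℤ))
            ((p : ℤ) ^ ((fun p => (a * b * c).factorization p / 2) p) -
              (((fun p => (a * b * c).factorization p / 2) p : ℕ) : ℤ) * (e : ℤ)) ≤
        ((e * (2 * (a * b * c).factorization p) / (2 * l) : ℕ) : ℤ) := by
  intro p hp hpabc hp2 hpl e he hle _h15 _h30 _hodd
  simp only []
  obtain ⟨hpltl, h4⟩ := hbad p hp hpabc hp2
  have ha : 0 < a := habc.1
  have hb : 0 < b := habc.2.1
  have hc : 0 < c := by have := habc.2.2.1; omega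
  have hN : 0 < a * b * c := by positivity
  -- notation
  set v := (a * b * c).factorization p with hv
  set A := v / 2 with hA
  have hv1 : 1 ≤ v := Nat.Prime.factorization_pos_of_dvd hp hN.ne' hpabc
  obtain ⟨k, rfl⟩ := hle
  have hk : 1 ≤ k := by
    rcases Nat.eq_zero_or_pos k with h | h
    · simp [h] at he
    · exact h
  refine ⟨fun m heq => ?_, fun i hi => ?_⟩
  · -- off the cyclotomic indices: `l ∣ p^m (p-1)` is impossible for the prime `l > p`
    have hcast : ((p : ℤ) - 1) = ((p - 1 : ℕ) : ℤ) := by rw [Nat.cast_sub hp.one_le]; simp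
    rw [hcast] at heq
    have heqN : l * k = p ^ m * (p - 1) := by exact_mod_cast heq
    have hdvd : l ∣ p ^ m * (p - 1) := ⟨k, heqN.symm⟩
    rcases (Nat.Prime.prime hl).dvd_or_dvd hdvd with h | h
    · have := (Nat.prime_dvd_prime_iff_eq hl hp).1 (hl.dvd_of_dvd_pow h); omega
    · have := Nat.le_of_dvd (by have := hp.two_le; omega) h; omega
  · -- the label cell
    -- `l = 2L + 1`
    have hl2 : l ≠ 2 := by omega
    have hodd : l % 2 = 1 := Nat.odd_iff.1 (hl.eq_two_or_odd'.resolve_left hl2)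
    set L := (l - 1) / 2 with hL
    have hlL : l = 2 * L + 1 := by omega
    -- the `q`-pilot order `e·2v/(2l) = k·v`
    have hH : l * k * (2 * v) / (2 * l) = k * v := by
      rw [show l * k * (2 * v) = (2 * l) * (k * v) by ring]
      exact Nat.mul_div_cancel_left _ (by omega)
    rw [hH]
    -- the floor and the `min`
    have he0 : ((l * k : ℕ) : ℤ) ≠ 0 := by exact_mod_cast he.ne'
    have hfloor : ∀ x : ℤ, ((l * k : ℕ) : ℤ) * (x / ((l * k : ℕ) : ℤ)) ≤ x := fun x => by
      rw [mul_comm]; exact Int.ediv_mul_le x he0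
    -- the different term and the inner-radius term
    have hD : (2 * (L : ℤ) + 1) * k - 1 ≤
        (((if p ∣ 30 ∧ ¬ p ∣ v then 2 * (l * k) - 1 else l * k - 1 : ℕ) : ℕ) : ℤ) := by
      have hlk1 : 1 ≤ l * k := he
      split_ifs
      · rw [Nat.cast_sub (by omega)]; push_cast; rw [hlL]; push_cast; nlinarith
      · rw [Nat.cast_sub hlk1]; push_cast; rw [hlL]; push_cast; linarith
    have hR : (0 : ℤ) ≤ (if p ∣ 30 then (((l * k / (p - 1) : ℕ) : ℤ)) else (1 : ℤ)) := by
      split_ifs <;> positivity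
    -- the core estimate
    have hJL : ((i + 1 : ℕ) : ℤ) ≤ L := by
      have : i + 1 ≤ L := hi
      exact_mod_cast this
    have hVA : (v : ℤ) ≤ 2 * (A : ℤ) + 1 := by
      have : v ≤ 2 * A + 1 := by omega
      exact_mod_cast this
    have hP1 : (1 : ℤ) ≤ (p : ℤ) ^ A := by exact_mod_cast Nat.one_le_pow A p hp.pos
    have hLP : 2 * (p : ℤ) ^ A ≤ L := by
      have : 2 * p ^ A ≤ L := by omega
      exact_mod_cast this
    have core := WRow.cell_core_of_large ((i + 1 : ℕ) : ℤ) L k v A ((p : ℤ) ^ A) _ _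
      (by exact_mod_cast Nat.succ_pos i) hJL (by exact_mod_cast hk) (by positivity) (by positivity) hVA hP1 hLP hD hR
    -- rewrite `i + 2 = (i+1) + 1` and `e = (2L+1)·k` in the goal, then chain
    have hi2 : ((i + 2 : ℕ) : ℤ) = ((i + 1 : ℕ) : ℤ) + 1 := by push_cast; ring
    have hlZ : (l : ℤ) = 2 * (L : ℤ) + 1 := by rw [hlL]; push_cast; ring
    have hmin := min_le_left ((p : ℤ) ^ A - (A : ℤ) * ((l * k : ℕ) : ℤ)) ((p : ℤ) ^ A - (A : ℤ) * ((l * k : ℕ) : ℤ))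
    have hJ1' : (0 : ℤ) ≤ ((i + 2 : ℕ) : ℤ) := by positivity
    have hmin' := mul_le_mul_of_nonneg_left hmin hJ1'
    have hfl := hfloor ((((i + 1 : ℕ) : ℤ) ^ 2 * ((k * v : ℕ) : ℤ) -
            ((i + 1 : ℕ) : ℤ) * (((if p ∣ 30 ∧ ¬ p ∣ v then 2 * (l * k) - 1 else l * k - 1 : ℕ) : ℕ) : ℤ) -
            ((i + 2 : ℕ) : ℤ) * (if p ∣ 30 then (((l * k / (p - 1) : ℕ) : ℤ)) else (1 : ℤ))))
    rw [hi2] at hfl hmin' ⊢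
    push_cast at core hfl hmin' ⊢
    simp only [hlZ] at core hfl hmin' ⊢
    linarith [core, hfl, hmin']


/-! ## §2. In particular at every prime `l > 4·√(abc)` -/

/-- **`hcell` for EVERY abc triple at EVERY prime `l` with `16·abc < l²`.** An odd prime `p ∣ abc` divides one of `a, b, c ≤ c`, and
`c² ≤ 2·abc` (`c = a + b ≤ 2·max(a,b)`, `min(a,b) ≥ 1`), so `p² ≤ 2·abc < l²`; and `(p^{⌊v_p/2⌋})² ≤ p^{v_p} ≤ abc`, so
`16·(p^{⌊v_p/2⌋})² < l²`; finally `abc ≥ 2` gives `l ≥ 5`. [cite: Mochizuki2012, IUTchIV Prop. 1.2 (i)(ii) p. 10, Prop. 1.4 (ii) p. 13]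
[claim: Mochizuki2012, status: disputed] -/
theorem WRow.hcell_triple_of_sq_lt {a b c l : ℕ} (habc : IsABCTriple a b c) (hl : l.Prime) (hbig : 16 * (a * b * c) < l ^ 2) :
    ∀ p : ℕ, p.Prime → p ∣ a * b * c → p ≠ 2 → p ≠ l → ∀ e : ℕ, 0 < e → l ∣ e →
      15 * l ∣ e * (a * b * c).factorization p → (p ∣ 30 → (p - 1) ∣ e) →
      (p ∣ c → Odd ((a * b * c).factorization p) → 30 * l ∣ e * (a * b * c).factorization p) →
      (∀ k : ℕ, (e : ℤ) ≠ (p : ℤ) ^ k * ((p : ℤ) - 1)) ∧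
      ∀ i : ℕ, i < (l - 1) / 2 →
        (e : ℤ) * ((((i + 1 : ℕ) : ℤ) ^ 2 * ((e * (2 * (a * b * c).factorization p) / (2 * l) : ℕ) : ℤ) -
            ((i + 1 : ℕ) : ℤ) * (((if p ∣ 30 ∧ ¬ p ∣ (a * b * c).factorization p then 2 * e - 1 else e - 1 : ℕ) : ℕ) : ℤ) -
            ((i + 2 : ℕ) : ℤ) * (if p ∣ 30 then (((e / (p - 1) : ℕ) : ℤ)) else (1 : ℤ))) / (e : ℤ)) +
          ((i + 2 : ℕ) : ℤ) * min ((p : ℤ) ^ ((fun p => (a * b * c).factorization p / 2) p) -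
              (((fun p => (a * b * c).factorization p / 2) p : ℕ) : ℤ) * (e : ℤ))
            ((p : ℤ) ^ ((fun p => (a * b * c).factorization p / 2) p) -
              (((fun p => (a * b * c).factorization p / 2) p : ℕ) : ℤ) * (e : ℤ)) ≤
        ((e * (2 * (a * b * c).factorization p) / (2 * l) : ℕ) : ℤ) := by
  have ha : 0 < a := habc.1
  have hb : 0 < b := habc.2.1
  have habc' : a + b = c := habc.2.2.1
  have hN : 0 < a * b * c := by have : 0 < c := by omega
                                positivity
  -- `l ≥ 5`: `abc ≥ 2` (`c ≥ 2`), so `l² > 32`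
  have hl5 : 5 ≤ l := by
    by_contra h
    have hl4 : l ≤ 4 := by omega
    have : l ^ 2 ≤ 4 ^ 2 := Nat.pow_le_pow_left hl4 2
    have hc2 : 2 ≤ c := by omega
    have : 2 ≤ a * b * c := le_trans hc2 (Nat.le_mul_of_pos_left c (Nat.mul_pos ha hb))
    omega
  refine WRow.hcell_triple_of_primePow_lt habc hl hl5 fun p hp hpabc _ => ⟨?_, ?_⟩
  · -- `p² ≤ c² ≤ 2abc < l²`
    have hpc : p ≤ c := by
      rcases (Nat.Prime.dvd_mul hp).1 hpabc with h | h
      · rcases (Nat.Prime.dvd_mul hp).1 h with h | h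
        · exact le_trans (Nat.le_of_dvd ha h) (by omega)
        · exact le_trans (Nat.le_of_dvd hb h) (by omega)
      · exact Nat.le_of_dvd (by omega) h
    have hc2 : c * c ≤ 2 * (a * b * c) := by
      rcases le_total a b with hab | hab
      · -- `c ≤ 2b`, `1 ≤ a`
        have h1 : c ≤ 2 * b := by omega
        have h2 : b ≤ a * b := Nat.le_mul_of_pos_left b ha
        nlinarith
      · have h1 : c ≤ 2 * a := by omega
        have h2 : a ≤ a * b := Nat.le_mul_of_pos_right a hb
        nlinarith
    have hpp : p * p < l * l := by nlinarith [Nat.mul_le_mul hpc hpc]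
    exact Nat.mul_self_lt_mul_self_iff.1 hpp
  · -- `(p^A)² ≤ p^v ≤ abc`, so `(4 p^A)² ≤ 16 abc < l²`
    set v := (a * b * c).factorization p with hv
    have hpv : p ^ v ≤ a * b * c := by rw [hv]; exact Nat.ordProj_le p hN.ne'
    have hsq : (p ^ (v / 2)) * (p ^ (v / 2)) ≤ a * b * c := by
      rw [← pow_two, ← pow_mul]
      exact le_trans (Nat.pow_le_pow_right hp.pos (show v / 2 * 2 ≤ v by omega)) hpv
    have h16 : (4 * p ^ (v / 2)) * (4 * p ^ (v / 2)) < l * l := by nlinarith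
    exact Nat.mul_self_lt_mul_self_iff.1 h16

/-! ## §3. S_H and the (U) number-level Corollary there -/

/-- **S_H INHABITED at EVERY genuine Θ-datum of EVERY abc triple (`j(a/c) ≠ 1728`) at EVERY prime `l ≥ 5` above the odd bad primes and
above `4·p^{⌊v_p(abc)/2⌋}`**: abc-iut-W-row-1's socket `WRow.licence_triple_unconditional` with `hcell := WRow.hcell_triple_of_primePow_lt` —
its conclusion VERBATIM: for every analytic `logv`, every context datum and EVERY pair of realising Θ- and q-ideles, `Thm311ToCor312.Licence` at
the sharp setting. [cite: Mochizuki2012, IUTchI Def. 3.1 (b),(c) pp. 61–62; IUTchIII Cor. 3.12 Step (xi-f) p. 184; IUTchIV Prop. 1.2 (i)(ii) p. 10,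
Prop. 1.4 (ii) p. 13] [cite: DupuyHilado2025, §3.3, §3.4, §4.9, §4.12] [claim: Mochizuki2012, status: disputed] -/
theorem WRow.licence_triple_of_primePow_lt {a b c l : ℕ} (habc : IsABCTriple a b c) (hj1728 : Cor22.jInv ((a : ℚ) / c) ≠ 1728)
    (hl : l.Prime) (hl5 : 5 ≤ l)
    (hbad : ∀ p : ℕ, p.Prime → p ∣ a * b * c → p ≠ 2 → p < l ∧ 4 * p ^ ((a * b * c).factorization p / 2) < l)
    (T : Cor22.ThetaVolumeDatumAt (ratPoint ((a : ℚ) / c)) l) :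
    letI := T.instFieldF; letI := T.instNumberFieldF; letI := T.instAlgebraF; letI := T.instFieldK
    letI := T.instNumberFieldK; letI := T.instAlgebraK; letI := T.instFieldFbar; letI := T.instAlgebraFbar
    letI := T.instAlgebraKFbar; letI := T.instIsElliptic
    ∀ {logv : PadicLogs T.K} (hlog : LogvAnalytic logv) (M : Type) [Field M] [NumberField M]
      (archPk : ∀ (j : (thetaIndex (pilotDataOfK T.D T.K)).Label) (vQ : (thetaIndex (pilotDataOfK T.D T.K)).VQ),
        Set ((logShellsDH (pilotDataOfK T.D T.K) logv).Packet j vQ))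
      (archSub : ∀ (j : (thetaIndex (pilotDataOfK T.D T.K)).Label) (v : (thetaIndex (pilotDataOfK T.D T.K)).V),
        Set ((logShellsDH (pilotDataOfK T.D T.K) logv).Packet j ((thetaIndex (pilotDataOfK T.D T.K)).over v)))
      (Ψ : ℤ → ∀ v : (thetaIndex (pilotDataOfK T.D T.K)).V, v ∈ (thetaIndex (pilotDataOfK T.D T.K)).Vbad →
        Set ((logShellsDH (pilotDataOfK T.D T.K) logv).StarPacket v))
      (act : ℤ → ∀ v : (thetaIndex (pilotDataOfK T.D T.K)).V, v ∈ (thetaIndex (pilotDataOfK T.D T.K)).Vbad →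
        (logShellsDH (pilotDataOfK T.D T.K) logv).StarPacket v → Module.End ℚ ((logShellsDH (pilotDataOfK T.D T.K) logv).StarPacket v))
      (Mmod : ℤ → ∀ j : (thetaIndex (pilotDataOfK T.D T.K)).LabelStar, Set ((logShellsDH (pilotDataOfK T.D T.K) logv).GlobalPacket j.1))
      (region : ℤ → ∀ j : (thetaIndex (pilotDataOfK T.D T.K)).LabelStar, FinDivisor M → ∀ vQ : (thetaIndex (pilotDataOfK T.D T.K)).VQ,
        Set ((logShellsDH (pilotDataOfK T.D T.K) logv).Packet j.1 vQ))
      (n : ℤ) {HT : Type} {LogLink : HT → HT → Type} {IsFull : ∀ {s t : HT}, LogLink s t → Prop}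
      (lat : LGPGaussianLogThetaLattice LogLink IsFull)
      {Frd : Type} {IsoF : Frd → Frd → Type} {Ob : Frd → Type} {realify : Frd → Frd} {Strip : Type}
      {IsoS : Strip → Strip → Type} {Mv : ∀ v : (thetaIndex (pilotDataOfK T.D T.K)).V, v ∈ (thetaIndex (pilotDataOfK T.D T.K)).Vbad → Type}
      [∀ v h, Monoid (Mv v h)]
      (sig : GlobalLGPFrobenioidSignature (thetaIndex (pilotDataOfK T.D T.K)).lstar (thetaIndex (pilotDataOfK T.D T.K)).V
        (· ∈ (thetaIndex (pilotDataOfK T.D T.K)).Vbad) Frd IsoF Ob realify Strip IsoS Mv)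
      (split : SplittingMonoids Mv) {ObΔ : Type} {N : ∀ v : (thetaIndex (pilotDataOfK T.D T.K)).V, v ∈ (thetaIndex (pilotDataOfK T.D T.K)).Vbad → Type}
      [∀ v h, Monoid (N v h)] (qData : QPilotData ObΔ N)
      (tq : ∀ (pp : Nat.Primes) (x : (thetaIndex (pilotDataOfK T.D T.K)).Fibre (.inr pp)),
        haveI : Fact (pp : ℕ).Prime := ⟨pp.2⟩; kOf (pilotDataOfK T.D T.K) pp.1 x)
      (t : ∀ (pp : Nat.Primes) (_ : Fin (pilotDataOfK T.D T.K).lstar) (x : (thetaIndex (pilotDataOfK T.D T.K)).Fibre (.inr pp)),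
        haveI : Fact (pp : ℕ).Prime := ⟨pp.2⟩; kOf (pilotDataOfK T.D T.K) pp.1 x)
      (htq0 : ∀ pp x, tq pp x ≠ 0)
      (htq1 : ∀ (pp : Nat.Primes) (x : (thetaIndex (pilotDataOfK T.D T.K)).Fibre (.inr pp)),
        haveI : Fact (pp : ℕ).Prime := ⟨pp.2⟩; placeOf (pilotDataOfK T.D T.K) pp.1 x ∉ (pilotDataOfK T.D T.K).S → ‖tq pp x‖ = 1)
      (_ht0 : ∀ pp i x, t pp i x ≠ 0)
      (_ht : ∀ (pp : Nat.Primes) (i : Fin (pilotDataOfK T.D T.K).lstar) (x : (thetaIndex (pilotDataOfK T.D T.K)).Fibre (.inr pp)),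
        haveI : Fact (pp : ℕ).Prime := ⟨pp.2⟩
        Real.log ‖t pp i x‖ = -((pilotDataOfK T.D T.K).thetaPilot i (placeOf (pilotDataOfK T.D T.K) pp.1 x)) *
          logNorm T.K (placeOf (pilotDataOfK T.D T.K) pp.1 x) / localDegree T.K (placeOf (pilotDataOfK T.D T.K) pp.1 x))
      (_htq : ∀ (pp : Nat.Primes) (x : (thetaIndex (pilotDataOfK T.D T.K)).Fibre (.inr pp)),
        haveI : Fact (pp : ℕ).Prime := ⟨pp.2⟩
        Real.log ‖tq pp x‖ = -((pilotDataOfK T.D T.K).qPilot (placeOf (pilotDataOfK T.D T.K) pp.1 x)) *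
          logNorm T.K (placeOf (pilotDataOfK T.D T.K) pp.1 x) / localDegree T.K (placeOf (pilotDataOfK T.D T.K) pp.1 x)),
      Thm311ToCor312.Licence
        (settingPrVolSharp (pilotDataOfK T.D T.K) hlog M archPk archSub Ψ act Mmod region n lat sig split qData tq t htq0 htq1) :=
  WRow.licence_triple_unconditional habc hj1728 T (fun p => (a * b * c).factorization p / 2)
    (fun p => (a * b * c).factorization p / 2) (WRow.hcell_triple_of_primePow_lt habc hl hl5 hbad)

/-- **THE NUMBER-LEVEL TYPED COR. 3.12 IN READING (U) AT EVERY GENUINE DATUM OF EVERY abc TRIPLE (`j ≠ 1728`), EVERY PRIME `l ≥ 5` WITH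
`p < l ∧ 4·p^{⌊v_p(abc)/2⌋} < l` FOR EVERY ODD PRIME `p ∣ abc`**: `T.Cor312Of`, NO other hypothesis — `WRow.licence_triple_of_primePow_lt` at
one-point context data and the chosen realising ideles of [IUTchI] Ex. 3.2 (iv), through abc-iut-C-cert-3's `GenuineK.cor312Of_of_licence` and the
K-level Θ-side bound (as in `WRow.cor312Of_triple_of_large`). For squarefree `abc`: every prime `l ≥ 5` above the largest odd prime factor.
[cite: Mochizuki2012, IUTchIII Cor. 3.12 p. 173–174; IUTchIV Cor. 2.2 (ii) proof (P5) p. 46] [claim: Mochizuki2012, status: disputed] -/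
theorem WRow.cor312Of_triple_of_primePow_lt {a b c l : ℕ} (habc : IsABCTriple a b c) (hj1728 : Cor22.jInv ((a : ℚ) / c) ≠ 1728)
    (hl : l.Prime) (hl5 : 5 ≤ l)
    (hbad : ∀ p : ℕ, p.Prime → p ∣ a * b * c → p ≠ 2 → p < l ∧ 4 * p ^ ((a * b * c).factorization p / 2) < l)
    (T : Cor22.ThetaVolumeDatumAt (ratPoint ((a : ℚ) / c)) l) : T.Cor312Of := by
  letI := T.instFieldF; letI := T.instNumberFieldF; letI := T.instAlgebraF; letI := T.instFieldK
  letI := T.instNumberFieldK; letI := T.instAlgebraK; letI := T.instFieldFbar; letI := T.instAlgebraFbar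
  letI := T.instAlgebraKFbar; letI := T.instIsElliptic
  obtain ⟨tq, htq0, htq1, htq⟩ := exists_realising_qIdeles_pilotDataOfK T.D
  obtain ⟨t, ht0, ht1, ht⟩ := exists_realising_thetaIdeles_pilotDataOfK T.D
  exact GenuineK.cor312Of_of_licence T.D T.K ℚ (fun _ _ => ∅) (fun _ _ => ∅) (fun _ _ _ => ∅) (fun _ _ _ => 0) (fun _ _ => ∅)
    (fun _ _ _ _ => ∅) 0 unitLatticeDH (unitSigDH (pilotDataOfK T.D T.K)) (unitSplitDH (pilotDataOfK T.D T.K))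
    (unitQDataDH (pilotDataOfK T.D T.K)) t tq T.isVolumeInputOf htq0 htq1 ht0 ht1 htq
    (WRow.licence_triple_of_primePow_lt habc hj1728 hl hl5 hbad T (logvAnalytic_analyticLogv (F := T.K)) ℚ (fun _ _ => ∅) (fun _ _ => ∅)
      (fun _ _ _ => ∅) (fun _ _ _ => 0) (fun _ _ => ∅) (fun _ _ _ _ => ∅) 0 unitLatticeDH (unitSigDH (pilotDataOfK T.D T.K))
      (unitSplitDH (pilotDataOfK T.D T.K)) (unitQDataDH (pilotDataOfK T.D T.K)) tq t htq0 htq1 ht0 ht htq)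
    (negLogTheta_settingPrVolSharp_pilotDataOfK_le_datum T ℚ (fun _ _ => ∅) (fun _ _ => ∅) (fun _ _ _ => ∅) (fun _ _ _ => 0) (fun _ _ => ∅)
      (fun _ _ _ _ => ∅) 0 unitLatticeDH (unitSigDH (pilotDataOfK T.D T.K)) (unitSplitDH (pilotDataOfK T.D T.K)) (unitQDataDH (pilotDataOfK T.D T.K))
      tq t htq0 htq1 ht0 ht)

/-- **`T.Cor312Of` (reading (U)) at EVERY genuine Θ-datum of EVERY abc triple (`j ≠ 1728`) at EVERY prime `l > 4·√(abc)`** (`16·abc < l²`).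
[cite: Mochizuki2012, IUTchIII Cor. 3.12 p. 173–174; IUTchIV Cor. 2.2 (ii) proof (P5) p. 46] [claim: Mochizuki2012, status: disputed] -/
theorem WRow.cor312Of_triple_of_sq_lt {a b c l : ℕ} (habc : IsABCTriple a b c) (hj1728 : Cor22.jInv ((a : ℚ) / c) ≠ 1728)
    (hl : l.Prime) (hbig : 16 * (a * b * c) < l ^ 2) (T : Cor22.ThetaVolumeDatumAt (ratPoint ((a : ℚ) / c)) l) : T.Cor312Of := by
  letI := T.instFieldF; letI := T.instNumberFieldF; letI := T.instAlgebraF; letI := T.instFieldK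
  letI := T.instNumberFieldK; letI := T.instAlgebraK; letI := T.instFieldFbar; letI := T.instAlgebraFbar
  letI := T.instAlgebraKFbar; letI := T.instIsElliptic
  obtain ⟨tq, htq0, htq1, htq⟩ := exists_realising_qIdeles_pilotDataOfK T.D
  obtain ⟨t, ht0, ht1, ht⟩ := exists_realising_thetaIdeles_pilotDataOfK T.D
  exact GenuineK.cor312Of_of_licence T.D T.K ℚ (fun _ _ => ∅) (fun _ _ => ∅) (fun _ _ _ => ∅) (fun _ _ _ => 0) (fun _ _ => ∅)
    (fun _ _ _ _ => ∅) 0 unitLatticeDH (unitSigDH (pilotDataOfK T.D T.K)) (unitSplitDH (pilotDataOfK T.D T.K))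
    (unitQDataDH (pilotDataOfK T.D T.K)) t tq T.isVolumeInputOf htq0 htq1 ht0 ht1 htq
    (WRow.licence_triple_unconditional habc hj1728 T (fun p => (a * b * c).factorization p / 2)
      (fun p => (a * b * c).factorization p / 2) (WRow.hcell_triple_of_sq_lt habc hl hbig) (logvAnalytic_analyticLogv (F := T.K)) ℚ
      (fun _ _ => ∅) (fun _ _ => ∅) (fun _ _ _ => ∅) (fun _ _ _ => 0) (fun _ _ => ∅) (fun _ _ _ _ => ∅) 0 unitLatticeDH
      (unitSigDH (pilotDataOfK T.D T.K)) (unitSplitDH (pilotDataOfK T.D T.K)) (unitQDataDH (pilotDataOfK T.D T.K)) tq t htq0 htq1 ht0 ht htq)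
    (negLogTheta_settingPrVolSharp_pilotDataOfK_le_datum T ℚ (fun _ _ => ∅) (fun _ _ => ∅) (fun _ _ _ => ∅) (fun _ _ _ => 0) (fun _ _ => ∅)
      (fun _ _ _ _ => ∅) 0 unitLatticeDH (unitSigDH (pilotDataOfK T.D T.K)) (unitSplitDH (pilotDataOfK T.D T.K)) (unitQDataDH (pilotDataOfK T.D T.K))
      tq t htq0 htq1 ht0 ht)

/-- **COFINITENESS IN `l` (reading (U)), sharp form**: for every abc triple with `j(a/c) ≠ 1728`, `T.Cor312Of` at every genuine Θ-datum of
`(a/c, l)` for every prime `l ≥ 4·Nat.sqrt(abc) + 5`. [cite: Mochizuki2012, IUTchIII Cor. 3.12 p. 173–174] [claim: Mochizuki2012, status: disputed] -/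
theorem WRow.cor312Of_triple_eventually_sqrt {a b c : ℕ} (habc : IsABCTriple a b c) (hj1728 : Cor22.jInv ((a : ℚ) / c) ≠ 1728) :
    ∀ l : ℕ, l.Prime → 4 * Nat.sqrt (a * b * c) + 5 ≤ l → ∀ T : Cor22.ThetaVolumeDatumAt (ratPoint ((a : ℚ) / c)) l, T.Cor312Of := by
  intro l hl hL T
  refine WRow.cor312Of_triple_of_sq_lt habc hj1728 hl ?_ T
  -- `abc < (√abc + 1)²` and `4(√abc + 1) < l`
  have h1 : a * b * c < (Nat.sqrt (a * b * c) + 1) ^ 2 := Nat.lt_succ_sqrt' (a * b * c)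
  have h2 : 4 * (Nat.sqrt (a * b * c) + 1) < l := by omega
  nlinarith [Nat.mul_lt_mul'' h2 h2]

end Summit.ABC.IUTFork.Conditional

end
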